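import Mathlib
import Literature.Analysis.Complex.HolomorphicParametricIntegral
import Literature.MathematicalPhysics.QuantumFieldTheory.OSReconstructionNoE1Proofs

/-!
# `stub_contractionFamily` (crux `PlanarSpectralCone`, line `two-mirror-lightcone-slots`) — candidate proof

drefute gen 4 (refuter-drefute-stmt-QuantumFields-9664-g4-0), evidence for the lead prover.
No `def`, no `local notation`, no `sorry`.

Route (DrefuteSurvivedG2.md §C.3, ONE Kolmogorov isometry, sharp constant): let `μ'` be a joint spectral
measure of `ψ'` (exists; finite, carried by `{p₀ ≥ 0}` and — by the global cone hypothesis — by the closed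
cone `{|p₁| ≤ p₀}`). For `t ≥ 0`, `b ∈ ℝ` put `e_{t,b}(p) = e^{−tp₀ + ibp₁} ∈ L²(μ')` and
`V_{t,b} = e^{-tH}U(be₁)ψ' ∈ ℋ`; the Gram identity `⟪e_{t,b}, e_{t',b'}⟫_{L²} = ⟪V_{t,b}, V_{t',b'}⟫_ℋ`
(self-adjointness of `e^{-tH}`, semigroup law, unitarity and commutation of `U`, the spectral identity)
makes the functional `∑ cᵢ e_{tᵢ,bᵢ} ↦ ⟪ψ, ∑ cᵢ V_{tᵢ,bᵢ}⟫` well defined on `span{e_{t,b}} ⊆ L²(μ')` and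
bounded by `‖ψ‖` (first isomorphism theorem); Hahn–Banach + Riesz give `g ∈ L²(μ')`, `‖g‖ ≤ ‖ψ‖`, with
`⟪g, e_{t,b}⟫ = ⟪ψ, V_{t,b}⟫`. Then `Φ(ζ,β) := ∫ conj(g) e^{−ζp₀ + iβp₁} dμ'` is holomorphic on
`D = {|Im β| < Re ζ}` (dominated holomorphic parameter integral on `ℂ × ℂ`: `|e^{−ζp₀+iβp₁}| ≤ 1` on the
cone), equals `⟪ψ, e^{-tH}U(be₁)ψ'⟫` at real points, and `|Φ| ≤ ‖g‖‖e_w‖_{L²} ≤ ‖ψ‖‖ψ'‖`.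
-/

noncomputable section

namespace DrefuteG4

open MeasureTheory Complex Set Filter Topology
open scoped InnerProductSpace ComplexConjugate NNReal ENNReal
open Literature.MathematicalPhysics.AQFT Literature.MathematicalPhysics.QuantumFieldTheory

/-! ## Kernel algebra -/

/-- `conj(e_{t,b}) · e_{t',b'} = e_{t+t', b'−b}` pointwise. -/
theorem conj_rKernel_mul_rKernel (t b t' b' : ℝ) (p : EuclideanSpace ℝ (Fin 4)) :
    conj (cexp ((((-(t * p 0)) : ℝ) : ℂ) + (((b * p 1) : ℝ) : ℂ) * I)) *
        cexp ((((-(t' * p 0)) : ℝ) : ℂ) + (((b' * p 1) : ℝ) : ℂ) * I) =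
      cexp ((((-((t + t') * p 0)) : ℝ) : ℂ) + ((((b' - b) * p 1) : ℝ) : ℂ) * I) := by
  rw [← Complex.exp_conj, ← Complex.exp_add]
  congr 1
  simp only [map_add, map_mul, Complex.conj_ofReal, Complex.conj_I]
  push_cast
  ring

theorem norm_rKernel (t b : ℝ) (p : EuclideanSpace ℝ (Fin 4)) :
    ‖cexp ((((-(t * p 0)) : ℝ) : ℂ) + (((b * p 1) : ℝ) : ℂ) * I)‖ = Real.exp (-(t * p 0)) := by
  rw [Complex.norm_exp]
  congr 1
  simp

theorem norm_rKernel_le_one {t : ℝ} (ht : 0 ≤ t) (b : ℝ) {p : EuclideanSpace ℝ (Fin 4)}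
    (hp : 0 ≤ p 0) : ‖cexp ((((-(t * p 0)) : ℝ) : ℂ) + (((b * p 1) : ℝ) : ℂ) * I)‖ ≤ 1 := by
  rw [norm_rKernel, Real.exp_le_one_iff, neg_nonpos]
  exact mul_nonneg ht hp

theorem norm_cKernel (w : ℂ × ℂ) (p : EuclideanSpace ℝ (Fin 4)) :
    ‖cexp (-(w.1 * ((p 0 : ℝ) : ℂ)) + w.2 * ((p 1 : ℝ) : ℂ) * I)‖ =
      Real.exp (-(w.1.re * p 0) - w.2.im * p 1) := by
  rw [Complex.norm_exp]
  congr 1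
  simp only [Complex.add_re, Complex.neg_re, Complex.mul_re, Complex.ofReal_re, Complex.ofReal_im,
    Complex.I_re, Complex.I_im, Complex.mul_im]
  ring

theorem norm_cKernel_le_one {w : ℂ × ℂ} (hw : |w.2.im| ≤ w.1.re) {p : EuclideanSpace ℝ (Fin 4)}
    (hp0 : 0 ≤ p 0) (hp1 : |p 1| ≤ p 0) :
    ‖cexp (-(w.1 * ((p 0 : ℝ) : ℂ)) + w.2 * ((p 1 : ℝ) : ℂ) * I)‖ ≤ 1 := by
  rw [norm_cKernel, Real.exp_le_one_iff]
  have h1 : -(|w.2.im| * |p 1|) ≤ w.2.im * p 1 := by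
    rw [← abs_mul]; exact neg_abs_le _
  have h2 : |w.2.im| * |p 1| ≤ |w.2.im| * p 0 := mul_le_mul_of_nonneg_left hp1 (abs_nonneg _)
  have h3 : |w.2.im| * p 0 ≤ w.1.re * p 0 := mul_le_mul_of_nonneg_right hw hp0
  linarith

theorem cKernel_ofReal (t b : ℝ) (p : EuclideanSpace ℝ (Fin 4)) :
    cexp (-(((t : ℂ), (b : ℂ)).1 * ((p 0 : ℝ) : ℂ)) + ((t : ℂ), (b : ℂ)).2 * ((p 1 : ℝ) : ℂ) * I) =
      cexp ((((-(t * p 0)) : ℝ) : ℂ) + (((b * p 1) : ℝ) : ℂ) * I) := by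
  congr 1
  push_cast
  ring

theorem continuous_rKernel (t b : ℝ) :
    Continuous fun p : EuclideanSpace ℝ (Fin 4) =>
      cexp ((((-(t * p 0)) : ℝ) : ℂ) + (((b * p 1) : ℝ) : ℂ) * I) := by
  fun_prop

theorem continuous_cKernel (w : ℂ × ℂ) :
    Continuous fun p : EuclideanSpace ℝ (Fin 4) =>
      cexp (-(w.1 * ((p 0 : ℝ) : ℂ)) + w.2 * ((p 1 : ℝ) : ℂ) * I) := by
  fun_prop

theorem differentiable_cKernel (c : ℂ) (p : EuclideanSpace ℝ (Fin 4)) :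
    Differentiable ℂ fun w : ℂ × ℂ => c * cexp (-(w.1 * ((p 0 : ℝ) : ℂ)) + w.2 * ((p 1 : ℝ) : ℂ) * I) := by
  fun_prop

/-- `⟪c e₁, p⟫ = c p₁`. -/
theorem inner_smul_single_one' (c : ℝ) (p : EuclideanSpace ℝ (Fin 4)) :
    ⟪(c • EuclideanSpace.single 1 1 : EuclideanSpace ℝ (Fin 4)), p⟫_ℝ = c * p 1 := by
  simp [inner_smul_left, EuclideanSpace.inner_single_left]

/-- The domain `D = {|Im β| < Re ζ}` is open. -/
theorem isOpen_coneDomain : IsOpen {w : ℂ × ℂ | |w.2.im| < w.1.re} :=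
  isOpen_lt (continuous_abs.comp (Complex.continuous_im.comp continuous_snd))
    (Complex.continuous_re.comp continuous_fst)

/-- Finite double sums `∑ᵢⱼ c̄ᵢ cⱼ ⟪uᵢ, uⱼ⟫` are `⟪∑ cᵢuᵢ, ∑ cᵢuᵢ⟫`. -/
theorem sum_sum_conj_mul_inner' {H : Type*} [NormedAddCommGroup H] [InnerProductSpace ℂ H]
    {ι : Type*} (s : Finset ι) (c : ι → ℂ) (u : ι → H) :
    ∑ a ∈ s, ∑ b ∈ s, conj (c a) * c b * ⟪u a, u b⟫_ℂ =
      ⟪∑ a ∈ s, c a • u a, ∑ a ∈ s, c a • u a⟫_ℂ := by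
  simp_rw [sum_inner, inner_sum, inner_smul_left, inner_smul_right]
  refine Finset.sum_congr rfl fun a _ => Finset.sum_congr rfl fun b _ => by ring

/-! ## The Gram identity on the Hilbert-space side -/

/-- `⟪e^{-tH}U(be₁)ψ', e^{-t'H}U(b'e₁)ψ'⟫ = ∫ e^{−(t+t')p₀ + i(b'−b)p₁} dμ'`. -/
theorem inner_transferTranslate_transferTranslate
    {ι : Type} {T : LabelledSchwingerFamily ι (EuclideanSpace ℝ (Fin 4))} (h : OSReconstructionNoE1 T)
    {ψ' : h.Hilbert} {μ' : Measure (EuclideanSpace ℝ (Fin 4))} (hμ' : h.IsJointSpectralMeasure ψ' μ')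
    {t t' : ℝ} (ht : 0 ≤ t) (ht' : 0 ≤ t') (b b' : ℝ) :
    ⟪h.transfer t (h.translate (b • EuclideanSpace.single 1 1) ψ'),
        h.transfer t' (h.translate (b' • EuclideanSpace.single 1 1) ψ')⟫_ℂ =
      ∫ p, cexp ((((-((t + t') * p 0)) : ℝ) : ℂ) + ((((b' - b) * p 1) : ℝ) : ℂ) * I) ∂μ' := by
  have hU : ∀ (a : EuclideanSpace ℝ (Fin 4)) (φ χ : h.Hilbert),
      ⟪h.translate a φ, χ⟫_ℂ = ⟪φ, h.translate (-a) χ⟫_ℂ := by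
    intro a φ χ
    have hχ : χ = h.translate a (h.translate (-a) χ) := by
      rw [← h.translate_add_apply, add_neg_cancel, h.translate_zero_apply]
    conv_lhs => rw [hχ]
    exact (h.translate a).inner_map_map φ _
  have hvec : -(b • EuclideanSpace.single 1 1 : EuclideanSpace ℝ (Fin 4)) + b' • EuclideanSpace.single 1 1 =
      (b' - b) • EuclideanSpace.single 1 1 := by
    rw [sub_smul, ← neg_add_eq_sub]
  calc ⟪h.transfer t (h.translate (b • EuclideanSpace.single 1 1) ψ'),
        h.transfer t' (h.translate (b' • EuclideanSpace.single 1 1) ψ')⟫_ℂ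
      = ⟪h.translate (b • EuclideanSpace.single 1 1) ψ',
          h.transfer t (h.transfer t' (h.translate (b' • EuclideanSpace.single 1 1) ψ'))⟫_ℂ :=
        h.inner_transfer_left t _ _
    _ = ⟪h.translate (b • EuclideanSpace.single 1 1) ψ',
          h.transfer (t + t') (h.translate (b' • EuclideanSpace.single 1 1) ψ')⟫_ℂ := by
        rw [h.transfer_add ht ht', ContinuousLinearMap.comp_apply]
    _ = ⟪ψ', h.translate (-(b • EuclideanSpace.single 1 1))
          (h.transfer (t + t') (h.translate (b' • EuclideanSpace.single 1 1) ψ'))⟫_ℂ := hU _ _ _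
    _ = ⟪ψ', h.transfer (t + t') (h.translate ((b' - b) • EuclideanSpace.single 1 1) ψ')⟫_ℂ := by
        rw [h.translate_transfer, ← h.translate_add_apply, hvec]
    _ = ∫ p, cexp ((((-((t + t') * p 0)) : ℝ) : ℂ) + ((((b' - b) * p 1) : ℝ) : ℂ) * I) ∂μ' := by
        rw [hμ'.inner_transfer_translate (t + t') (add_nonneg ht ht') _ (by simp)]
        simp_rw [inner_smul_single_one']

/-! ## The stub -/

/-- **TRANSFER C⁺ ⇒ C — the holomorphic contraction family on the operator cone.** (Signature verbatim
from the lead's skeleton, sha fe3e5eda.) -/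
theorem stub_contractionFamily
    {ι : Type} {T : LabelledSchwingerFamily ι (EuclideanSpace ℝ (Fin 4))} (h : OSReconstructionNoE1 T)
    (hcone : ∀ (ψ : h.Hilbert) (μ : Measure (EuclideanSpace ℝ (Fin 4))), h.IsJointSpectralMeasure ψ μ →
      μ {p | p 0 < |p 1|} = 0)
    (ψ ψ' : h.Hilbert) :
    ∃ Φ : ℂ × ℂ → ℂ, DifferentiableOn ℂ Φ {w : ℂ × ℂ | |w.2.im| < w.1.re} ∧
      (∀ t b : ℝ, 0 < t → Φ ((t : ℂ), (b : ℂ)) =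
        ⟪ψ, h.transfer t (h.translate (b • EuclideanSpace.single 1 1) ψ')⟫_ℂ) ∧
      ∀ w ∈ {w : ℂ × ℂ | |w.2.im| < w.1.re}, ‖Φ w‖ ≤ ‖ψ‖ * ‖ψ'‖ := by
  classical
  -- the joint spectral measure of `ψ'`: finite, on `{p₀ ≥ 0}`, on the closed cone
  obtain ⟨μ', hμ'⟩ := OSReconstructionNoE1.exists_isJointSpectralMeasure_holds h ψ'
  haveI := hμ'.isFiniteMeasure
  have hae0 : ∀ᵐ p ∂μ', (0 : ℝ) ≤ p 0 := by
    rw [ae_iff]; simpa only [not_le] using hμ'.energy_nonneg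
  have haec : ∀ᵐ p ∂μ', |p 1| ≤ p 0 := by
    rw [ae_iff]; simpa only [not_le] using hcone ψ' μ' hμ'
  have hae : ∀ᵐ p ∂μ', (0 : ℝ) ≤ p 0 ∧ |p 1| ≤ p 0 := hae0.and haec
  -- index set of real points, kernel functions, their `L²` classes, and the Hilbert-space vectors
  let R : Type := {tb : ℝ × ℝ // 0 ≤ tb.1}
  let e : R → EuclideanSpace ℝ (Fin 4) → ℂ := fun r p =>
    cexp ((((-(r.1.1 * p 0)) : ℝ) : ℂ) + (((r.1.2 * p 1) : ℝ) : ℂ) * I)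
  have he : ∀ r : R, MemLp (e r) 2 μ' := fun r =>
    MemLp.of_bound (continuous_rKernel r.1.1 r.1.2).aestronglyMeasurable 1
      (by filter_upwards [hae0] with p hp using norm_rKernel_le_one r.2 r.1.2 hp)
  let E : R → Lp ℂ 2 μ' := fun r => (he r).toLp (e r)
  have hE : ∀ r : R, (E r : EuclideanSpace ℝ (Fin 4) → ℂ) =ᵐ[μ'] e r := fun r => (he r).coeFn_toLp
  let V : R → h.Hilbert := fun r =>
    h.transfer r.1.1 (h.translate (r.1.2 • EuclideanSpace.single 1 1) ψ')
  -- the Gram identity `⟪E r, E s⟫ = ⟪V r, V s⟫`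
  have hgram : ∀ r s : R, ⟪E r, E s⟫_ℂ = ⟪V r, V s⟫_ℂ := by
    intro r s
    rw [MeasureTheory.L2.inner_def, inner_transferTranslate_transferTranslate h hμ' r.2 s.2 r.1.2 s.1.2]
    refine integral_congr_ae ?_
    filter_upwards [hE r, hE s] with p hr hs
    rw [hr, hs, RCLike.inner_apply, mul_comm]
    exact conj_rKernel_mul_rKernel r.1.1 r.1.2 s.1.1 s.1.2 p
  -- linear combinations
  set ΛE : (R →₀ ℂ) →ₗ[ℂ] Lp ℂ 2 μ' := Finsupp.linearCombination ℂ E with hΛE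
  set ΛV : (R →₀ ℂ) →ₗ[ℂ] h.Hilbert := Finsupp.linearCombination ℂ V with hΛV
  have hnorm : ∀ l, ‖ΛV l‖ = ‖ΛE l‖ := by
    intro l
    have hV' : ΛV l = ∑ a ∈ l.support, l a • V a := by
      rw [hΛV, Finsupp.linearCombination_apply, Finsupp.sum]
    have hE' : ΛE l = ∑ a ∈ l.support, l a • E a := by
      rw [hΛE, Finsupp.linearCombination_apply, Finsupp.sum]
    have hinner : ⟪ΛV l, ΛV l⟫_ℂ = ⟪ΛE l, ΛE l⟫_ℂ := by
      rw [hV', hE', ← sum_sum_conj_mul_inner', ← sum_sum_conj_mul_inner']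
      simp_rw [hgram]
    have h1 := inner_self_eq_norm_sq (𝕜 := ℂ) (ΛV l)
    have h2 := inner_self_eq_norm_sq (𝕜 := ℂ) (ΛE l)
    rw [hinner] at h1
    have h3 : ‖ΛV l‖ ^ 2 = ‖ΛE l‖ ^ 2 := by rw [← h1, ← h2]
    exact (pow_left_inj₀ (norm_nonneg _) (norm_nonneg _) two_ne_zero).1 h3
  -- the functional `l ↦ ⟪ψ, ΛV l⟫` and its Cauchy–Schwarz bound
  set L : (R →₀ ℂ) →ₗ[ℂ] ℂ := (innerSL ℂ ψ : h.Hilbert →L[ℂ] ℂ).toLinearMap ∘ₗ ΛV with hL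
  have hLapply : ∀ l, L l = ⟪ψ, ΛV l⟫_ℂ := fun l => rfl
  have hbound : ∀ l, ‖L l‖ ≤ ‖ψ‖ * ‖ΛE l‖ := by
    intro l
    rw [hLapply, ← hnorm]
    exact norm_inner_le_norm _ _
  -- first isomorphism theorem: `L` descends to the range of `ΛE`
  have hker : LinearMap.ker ΛE ≤ LinearMap.ker L := fun l hl => by
    rw [LinearMap.mem_ker] at hl ⊢
    have := hbound l
    rw [hl, norm_zero, mul_zero] at this
    exact norm_le_zero_iff.1 this
  set L' : LinearMap.range ΛE →ₗ[ℂ] ℂ :=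
    ((LinearMap.ker ΛE).liftQ L hker).comp ΛE.quotKerEquivRange.symm.toLinearMap with hL'
  have hL'apply : ∀ l, L' ⟨ΛE l, LinearMap.mem_range_self ΛE l⟩ = L l := by
    intro l
    have hq : ΛE.quotKerEquivRange.symm ⟨ΛE l, LinearMap.mem_range_self ΛE l⟩ =
        Submodule.Quotient.mk l := by
      rw [LinearEquiv.symm_apply_eq]
      apply Subtype.ext
      rw [LinearMap.quotKerEquivRange_apply_mk]
    simp only [hL', LinearMap.comp_apply, LinearEquiv.coe_toLinearMap, hq, Submodule.liftQ_apply]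
  have hL'bound : ∀ v : LinearMap.range ΛE, ‖L' v‖ ≤ ‖ψ‖ * ‖v‖ := by
    rintro ⟨v, hv⟩
    obtain ⟨l, rfl⟩ := LinearMap.mem_range.1 hv
    rw [hL'apply l]
    exact hbound l
  set L'c : LinearMap.range ΛE →L[ℂ] ℂ := L'.mkContinuous ‖ψ‖ hL'bound with hL'c
  have hL'c_norm : ‖L'c‖ ≤ ‖ψ‖ := LinearMap.mkContinuous_norm_le _ (norm_nonneg _) _
  -- Hahn–Banach and Riesz in `L²(μ')`
  obtain ⟨gext, hgext, hgext_norm⟩ := exists_extension_norm_eq (LinearMap.range ΛE) L'c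
  set g : Lp ℂ 2 μ' := (InnerProductSpace.toDual ℂ (Lp ℂ 2 μ')).symm gext with hg
  have hg_inner : ∀ v, ⟪g, v⟫_ℂ = gext v := fun v => InnerProductSpace.toDual_symm_apply
  have hg_norm : ‖g‖ ≤ ‖ψ‖ := by
    rw [hg, LinearIsometryEquiv.norm_map, hgext_norm]; exact hL'c_norm
  have hgE : ∀ r : R, ⟪g, E r⟫_ℂ = ⟪ψ, V r⟫_ℂ := by
    intro r
    have hΛ1 : ΛE (Finsupp.single r 1) = E r := by
      rw [hΛE, Finsupp.linearCombination_single, one_smul]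
    have hΛV1 : ΛV (Finsupp.single r 1) = V r := by
      rw [hΛV, Finsupp.linearCombination_single, one_smul]
    calc ⟪g, E r⟫_ℂ = gext (E r) := hg_inner _
      _ = gext (ΛE (Finsupp.single r 1)) := by rw [hΛ1]
      _ = L'c ⟨ΛE (Finsupp.single r 1), LinearMap.mem_range_self ΛE _⟩ :=
          hgext ⟨ΛE (Finsupp.single r 1), LinearMap.mem_range_self ΛE _⟩
      _ = L (Finsupp.single r 1) := by rw [hL'c, LinearMap.mkContinuous_apply, hL'apply]
      _ = ⟪ψ, V r⟫_ℂ := by rw [hLapply, hΛV1]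
  -- `g` as a function: square integrable, hence integrable (finite measure)
  have hg_int : Integrable (fun p => (g : EuclideanSpace ℝ (Fin 4) → ℂ) p) μ' :=
    (Lp.memLp g).integrable one_le_two
  -- the function
  refine ⟨fun w => ∫ p, conj ((g : EuclideanSpace ℝ (Fin 4) → ℂ) p) *
      cexp (-(w.1 * ((p 0 : ℝ) : ℂ)) + w.2 * ((p 1 : ℝ) : ℂ) * I) ∂μ', ?_, ?_, ?_⟩
  · -- holomorphy on `D`: dominated holomorphic parameter integral on `ℂ × ℂ`
    refine Literature.Analysis.Complex.differentiableOn_integral_of_dominated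
      (fun w _ => ((Lp.aestronglyMeasurable g).star.mul (continuous_cKernel w).aestronglyMeasurable))
      (Eventually.of_forall fun p => (differentiable_cKernel _ p).differentiableOn)
      fun w₀ hw₀ => ?_
    obtain ⟨ρ, hρ, hball⟩ := Metric.isOpen_iff.1 isOpen_coneDomain w₀ hw₀
    refine ⟨ρ, hρ, hball, fun p => ‖(g : EuclideanSpace ℝ (Fin 4) → ℂ) p‖, hg_int.norm, ?_⟩
    filter_upwards [hae] with p hp
    intro w hw
    rw [norm_mul, RCLike.norm_conj]
    have := norm_cKernel_le_one (le_of_lt (hball hw)) hp.1 hp.2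
    calc ‖(g : EuclideanSpace ℝ (Fin 4) → ℂ) p‖ * ‖cexp (-(w.1 * ((p 0 : ℝ) : ℂ)) + w.2 * ((p 1 : ℝ) : ℂ) * I)‖
        ≤ ‖(g : EuclideanSpace ℝ (Fin 4) → ℂ) p‖ * 1 := by gcongr
      _ = ‖(g : EuclideanSpace ℝ (Fin 4) → ℂ) p‖ := mul_one _
  · -- real points
    intro t b ht
    let r : R := ⟨(t, b), ht.le⟩
    have h1 : (∫ p, conj ((g : EuclideanSpace ℝ (Fin 4) → ℂ) p) *
        cexp (-(((t : ℂ), (b : ℂ)).1 * ((p 0 : ℝ) : ℂ)) + ((t : ℂ), (b : ℂ)).2 * ((p 1 : ℝ) : ℂ) * I) ∂μ') =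
        ⟪g, E r⟫_ℂ := by
      rw [MeasureTheory.L2.inner_def]
      refine integral_congr_ae ?_
      filter_upwards [hE r] with p hp
      rw [hp, RCLike.inner_apply, cKernel_ofReal]
      exact mul_comm _ _
    show (∫ p, conj ((g : EuclideanSpace ℝ (Fin 4) → ℂ) p) *
        cexp (-(((t : ℂ), (b : ℂ)).1 * ((p 0 : ℝ) : ℂ)) + ((t : ℂ), (b : ℂ)).2 * ((p 1 : ℝ) : ℂ) * I) ∂μ') = _
    rw [h1, hgE r]
  · -- the bound `‖Φ w‖ ≤ ‖g‖ ‖e_w‖ ≤ ‖ψ‖ ‖ψ'‖`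
    intro w hw
    have hFw : MemLp (fun p : EuclideanSpace ℝ (Fin 4) =>
        cexp (-(w.1 * ((p 0 : ℝ) : ℂ)) + w.2 * ((p 1 : ℝ) : ℂ) * I)) 2 μ' :=
      MemLp.of_bound (continuous_cKernel w).aestronglyMeasurable 1
        (by filter_upwards [hae] with p hp using norm_cKernel_le_one (le_of_lt hw) hp.1 hp.2)
    set Fw : Lp ℂ 2 μ' := hFw.toLp _ with hFw_def
    have hFw_ae : (Fw : EuclideanSpace ℝ (Fin 4) → ℂ) =ᵐ[μ']
        fun p => cexp (-(w.1 * ((p 0 : ℝ) : ℂ)) + w.2 * ((p 1 : ℝ) : ℂ) * I) := hFw.coeFn_toLp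
    have h1 : (∫ p, conj ((g : EuclideanSpace ℝ (Fin 4) → ℂ) p) *
        cexp (-(w.1 * ((p 0 : ℝ) : ℂ)) + w.2 * ((p 1 : ℝ) : ℂ) * I) ∂μ') = ⟪g, Fw⟫_ℂ := by
      rw [MeasureTheory.L2.inner_def]
      refine integral_congr_ae ?_
      filter_upwards [hFw_ae] with p hp
      rw [hp, RCLike.inner_apply, mul_comm]
    have hFw_norm : ‖Fw‖ ≤ ‖ψ'‖ := by
      have hb := Lp.norm_le_of_ae_bound (f := Fw) zero_le_one
        (by filter_upwards [hFw_ae, hae] with p hp hp'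
            rw [hp]; exact norm_cKernel_le_one (le_of_lt hw) hp'.1 hp'.2)
      have hm : (measureUnivNNReal μ' : ℝ) = ‖ψ'‖ ^ 2 := by
        rw [← hμ'.measureReal_univ, measureReal_def]
        rfl
      rw [mul_one] at hb
      refine hb.trans (le_of_eq ?_)
      rw [hm]
      have : ((2 : ℝ≥0∞).toReal)⁻¹ = ((2 : ℕ) : ℝ)⁻¹ := by norm_num
      rw [this, Real.pow_rpow_inv_natCast (norm_nonneg _) two_ne_zero]
    show ‖∫ p, conj ((g : EuclideanSpace ℝ (Fin 4) → ℂ) p) *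
        cexp (-(w.1 * ((p 0 : ℝ) : ℂ)) + w.2 * ((p 1 : ℝ) : ℂ) * I) ∂μ'‖ ≤ ‖ψ‖ * ‖ψ'‖
    rw [h1]
    calc ‖⟪g, Fw⟫_ℂ‖ ≤ ‖g‖ * ‖Fw‖ := norm_inner_le_norm _ _
      _ ≤ ‖ψ‖ * ‖ψ'‖ := by gcongr

end DrefuteG4
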